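import Mathlib
import Literature.MathematicalPhysics.QuantumFieldTheory.Balaban1983to89.B5DeltaA169

/-!
# Beta/DeltaACombesThomas — the Combes–Thomas bound with the cosh law and PAIRWISE weights
# (complex Hermitian, sesquilinear), the kernel form of (1.90) for `Δ_a`, and the L²-form decay of
# `𝒢(a) = Δ_a⁻¹` MODULO the row defect of `∂P∂*` (= the content of (1.126))

HONEST SCOPE (page 1 of everything in this cell): discharging `BetaPertH` makes Bałaban's UV stability
UNCONDITIONAL — a real constructive-QFT result; it is NOT the continuum limit and NOT the Clay problem.
This is a FREE-SIDE (`U = 1`) kernel-depth module of the β sub-cell (unit `b2b-balaban-beta-an5`,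
node BETA-an5-COVARIANT-CT; `U = 1` throughout — the vector operator `Δ_a`, not a
covariant `U ≠ 1` object), aimed at the α-leaf `h12 = B5.Prop12Printed` (exponential decay of
`G = Δ_a⁻¹`, Prop. 1.2) on which the vector-leg adapters of the β wall (`Beta.VectorTailsLoc`,
`Beta.VectorLegVolumeAdapter`) are conditional.  It does NOT discharge `h12`, it does NOT touch
`BetaPertH`, it claims nothing about `β`, the far regions or the summit, and nothing in it is a
cited fact: every declaration below is PROVED in the kernel; the `[cite: …]` tags record the
printed provenance of the OBJECTS (`Δ_a`, `Q_k`, `P`, the blocks) — TEXT LOCATIONS ONLY, nothing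
printed enters as a hypothesis (ABSOLUTE RULE) — and the `[folklore]` tags mark method lemmas.

Source: T. Bałaban, *Propagators and renormalization transformations for lattice gauge
theories. I*, Commun. Math. Phys. 95 (1984) 17–40 (`Balaban1984PropagatorsI`, "B5").

## What the paper prints (verbatim; journal pages)

p. 29, Sect. E: «⟨A, Δ_a A⟩ = ⟨A, ∂*∂A⟩ + ⟨A, ∂R∂*A⟩ + a⟨A, Q*QA⟩ = ⟨A, ΔA⟩ − ⟨A, ∂P∂*A⟩ + a⟨A, Q*QA⟩,
  (1.69)  Δ = ∂*∂ + ∂∂*, R = I − P,»;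
p. 30: «The configuration ∂*A is orthogonal to constant functions and on such configurations the
  operator P is given by the formula P = Δ⁻¹Q′*(Q′Δ⁻²Q′*)⁻¹Q′Δ⁻¹. (1.70)  We will obtain an
  explicit representation of Δ_a⁻¹ = G_k, or simply G. (1.71)»;
p. 33, Proposition 1.1: «… ≤ γ₀^{−1}‖J‖, (1.89) with a positive constant γ₀ independent of k, T_η,
  and depending on d only (if we put a = 1).  This implies the bound from below:
  Δ_a = G^{−1} ≥ γ₀(Δ + I). (1.90)»;
pp. 35–36, Proposition 1.2: «There exists a positive constant δ₀ depending on d only, such that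
  |(GJ)(x)|, |(∇GJ)(x)|, |(G∇*J)(x)|, |(ΔGJ)(x)| ≤ O(1)e^{−δ₀|y−y′|}|J| (1.110) for x ∈ Δ̃(y),
  supp J ⊂ Δ̃(y′), with the constant O(1) depending on d only, …»;
p. 38: «Let us write bounds for the operator ∂P∂*. They follow from the representation
  P = G′Q′*(Q′G′²Q′*)⁻¹Q′G′, from Lemma 2.4 of [2], and the representation (1.45) and the
  analyticity method of proving an exponential decay (see the proof of Lemma 2.4 in [2]). We obtain
  |(∂P∂*)_{μ,ν}(x, x′)| ≤ O(1)e^{−δ′₀|x−x′|}, (1.126)».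
The PRINTED proof of Proposition 1.2 (pp. 38–39) is the random-walk expansion (1.128)–(1.131) of
`G` around the operators `G₀(□)` with Neumann-type localisation, USING (1.126)–(1.127) — typed as
`B5.prop12_of_printed_steps` with (1.126)–(1.127) the leaf `B5.Kernel126_127Printed`.  The route of
this module (Combes–Thomas conjugation) is NOT the printed one; it is recorded as OURS throughout.

## What this module proves (all sorry-free; constants explicit)

§1 (generic, `ι` finite, `A : Matrix ι ι ℂ` Hermitian).  With the PAIRWISE weight
`w_{κ,ρ}(e,e′) = cosh(κ(ρ(e) − ρ(e′))) − 1 ≥ 0` and the ROW DEFECT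
`defect_{κ,ρ}(A)(e) = Σ_{e′} ‖A(e,e′)‖·w_{κ,ρ}(e,e′)`:
* `conjugated_form_coercive`: if `Re⟨x, Ax⟩ ≥ γ‖x‖²` and `defect ≤ J` row-wise, then
  `Re Σ conj(z_e) e^{κ(ρ_e − ρ_{e′})} A(e,e′) z_{e′} ≥ (γ − J)‖z‖²` (cosh symmetrisation
  `re_conjugated_form` + Schur);
* `combesThomas_pairwise` / `combesThomas_pairwise_inv` (MAIN generic): for `κ ≥ 0`, `J < γ`,
  `u` supported in `{ρ ≥ R}`, `v` in `{ρ ≤ 0}`: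
  `‖u* · A⁻¹v‖ ≤ e^{−κR}/(γ − J) · ‖u‖‖v‖`.
§2 (`Δ_a` of (1.69), `B5DeltaA169.DeltaA n M a`, fine torus `T_η = Tor (fine n M)`, `η = 1/n`):
* `re_form_DeltaA_ge`: `Re⟨A, Δ_aA⟩ ≥ γ(d,a)‖A‖²`, `γ(d,a) = gammaA d a = 1/((d+1)·Cst(d,a)) > 0`
  — the kernel form of (1.90) (from `B5Prop11Lower.lowerBound_re`, `B5DeltaA169.calDa_eq_DeltaA`),
  free of `n = L^k` and of the torus;
* `calG_form_decay`: the §1 bound for `𝒢(a) = calG = Δ_a⁻¹` given ANY row-defect bound `J < γ`;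
* `ctRowDefect_DeltaA_le`: `defect(Δ_a) ≤ defect(Δ) + defect(∂P∂*) + |a|·defect(Q*Q)`.
§3 (the Laplacian `Δ = Σ_ν ∇_ν^*∇_ν`, entries `n²` on nearest neighbours):
* `ctRowDefect_Lap_le`: `ρ` `ℓ`-Lipschitz along fine bonds ⇒ `defect(Δ)(e) ≤ 2d·n²(cosh κℓ − 1)`;
* `ctRowDefect_Lap_le_uniform`: at the block scale `ℓ = 1/n`, `defect(Δ)(e) ≤ dκ²e^{κ²/2}` — the
  `n`-UNIFORMITY (`n²(cosh(κ/n) − 1) ≤ (κ²/2)e^{κ²/2}`, `sq_mul_cosh_div_sub_one_le`).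
§4 (the block average `Q_k` (1.18), `Q_k^* = n^d·Q_kᴴ` = `B5DeltaA169.QvAdj`):
* `sum_qr_row`, `sum_qr_col`: row sums of `|Q_k|` are `1`, column sums `n^{−d}` ((1.6): the blocks
  partition `T_η`, `B5Blocks16.bpt_bijective`);
* `ctRowDefect_QvAdj_QvOp_le`: `ρ` oscillating by `≤ L` on the extended block stencils ⇒
  `defect(Q_k^*Q_k)(e) ≤ cosh(κL) − 1` (the `n^d` of `Q_k^*` against the column sums `n^{−d}`).
§5 (assembly): `ctRowDefect_DeltaA_le_of_pieces` and the deliverable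
* `calG_form_decay_of_pieces`: for `ρ` `1/n`-Lipschitz on fine bonds with stencil oscillation
  `≤ L`, ANY bound `J_P` on `defect(∂P∂*)`, and `dκ²e^{κ²/2} + |a|(cosh κL − 1) + J_P < γ(d,a)`:
  `|⟨u, 𝒢(a)v⟩| ≤ e^{−κR}/(γ(d,a) − dκ²e^{κ²/2} − |a|(cosh κL − 1) − J_P)·‖u‖‖v‖`
  for `u` supported in `{ρ ≥ R}`, `v` in `{ρ ≤ 0}` — every constant free of `n` and of `T_η`.

## Finding recorded for the β-cell (why `∂P∂*` stays a hypothesis)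

`P` (1.70) = `B5Value126.PcT` contains `Δ⁻¹` and `(Q′Δ⁻²Q′*)⁻¹`: it is NOT a finite-range
operator on `T_η`, so the Combes–Thomas conjugation of `Δ_a = Δ − ∂P∂* + aQ*Q` cannot be closed
from the algebra of (1.69)–(1.73) alone — the row defect of `∂P∂*` needs a DECAY INPUT on the kernel
`(∂P∂*)_{μν}(x,x′)`, and that input is exactly (1.126), whose printed proof (p. 38) goes through the
second representation `P = G′Q′*(Q′G′²Q′*)⁻¹Q′G′` ((1.44)/(1.45)) and the analyticity method of
[2] = B4, Lemma 2.4.  Consequently `h12 ⇐` {this module} + {a row-defect form of (1.126)} + {the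
passage from L²-form decay to the sup-norm/Hölder entries (1.110)–(1.114)}; the module isolates the
(1.126) dependence as the single named hypothesis `hP` of §5 and certifies everything else with
`n`-free constants.

## Nearest tree neighbours, and the delta (searched: `Beta/CombesThomas*`, `Beta/TorusG0*`,
## `MassGapFunctionalInequalities`, `QGQInverse`, `B5Decay126`, `T4ConstrainedAgmon*`)

* THE an2/pv23 COMBES–THOMAS CHAIN `Beta/CombesThomasForm` (`combesThomas_form`, `conjError_lap_ge`,
  `conjError_blocks_ge`, `lapDefect_le`), `Beta/CombesThomasFormOp` (`combesThomas_form_op`,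
  `setDecay_lattice_dist`), `Beta/CombesThomasKernel` (`defect_symm_eq_cosh`,
  `conjError_symmKernel_ge`, `setDecay_torus_kernel`), `Beta/CombesThomasKernelTail`, and its torus
  instance `Beta/TorusG0Decay`/`TorusG0Kernel`/`TorusG0GradDecay`/`TorusG0DivDecay` (the SCALAR
  `G₀ = (−Δ^η + aQ′*Q′)⁻¹`, `torusOp n M a`, REAL matrices on `Tor (fine (n+1) M)`, concrete
  distances `ldist`/`edist`, set-to-set decay, `η`-uniform).  THE MECHANISM OF §1 BELOW IS THE SAME
  (cosh symmetrisation of the conjugation defect of a symmetric kernel + Schur, second order in the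
  weight step) — §1 is its complex-Hermitian, SESQUILINEAR counterpart in pairing form
  (`‖u*·A⁻¹v‖ ≤ e^{−κR}/(γ − J)·‖u‖‖v‖`), re-proved over `ℂ` (not transferred) because the tree
  types the B5 operators `Δ_a`, `𝒢`, `Q_k`, `P` as complex matrices (Fourier blocks,
  `B5Prop11Plancherel`…`B5DeltaA169`).  No novelty of method is claimed for §1.  What is NEW here
  relative to that chain: (a) the OBJECT — the vector operator `Δ_a` of (1.69) WITH the term
  `−∂P∂*`, i.e. the B5 propagator `G = Δ_a⁻¹ = 𝒢` of (1.71)/(1.83) itself (not `G₀`), with the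
  coercivity constant of the kernel form of Prop. 1.1 (`B5Prop11Lower`, `B5DeltaA169`) and no
  size hypothesis on the torus (the chain's `3 ≤ fine (n+1) M μ` is not needed: §3 works with entry
  indicators); (b) the VECTOR block average `Q_k` (1.18) with its line sums — `Q_k^*Q_k` is not a
  sum of rank-one block projections (the stencils of adjacent `b` overlap along `μ`), and §4 bounds
  its defect through the row/column sums `1`, `n^{−d}` of `|Q_k|` (`B5Blocks16.bpt_bijective`);
  (c) the isolation of the (1.126) input as the single hypothesis `hP` (same SHAPE as the chain's
  symmetric-kernel hypothesis `hrow` of `conjError_symmKernel_ge`, here for `K = −∂P∂*` over `ℂ`).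
* `MassGapFunctionalInequalities.combesThomas_cosh_bound` (ref2): real symmetric, ONE Lipschitz
  scale (`|ρ(e) − ρ(e′)| ≤ 1` on the support of `A`), defect `J(cosh κ − 1)`; §1 has pairwise
  weights summed against `‖A(e,e′)‖` instead (entries of `Δ_a` occur at every `ρ`-distance through
  `P`, and the nearest-neighbour entries `n²` at `ρ`-distance `1/n` pair with
  `cosh(κ/n) − 1 ≍ κ²/2n²`, §3).
* `QGQInverse.inverse_decay`, `B5Decay126.PosDecay.inv` (entrywise Neumann/Schur, linear law):
  applied to `Δ_a` the admissible rate is tied to the entry size `n²` and the profile constant grows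
  like `n^d` — not uniform in `n`; not used.  `T4ConstrainedAgmon(D)` (T4 cell): different object.
* `B5DeltaA169` supplies `Δ_a = 𝒟_a` (`calDa_eq_DeltaA`), `DeltaA_isHermitian`, `isUnit_DeltaA`,
  `calG_eq_DeltaA_inv`; `B5Prop11Lower` the (1.90)-type lower bound `lowerBound_re` with `Cst d a`.
In print, the square-root (cosh) law of a Combes–Thomas rate: [cite: Klein1999LocalizationOfLight,
Theorem 2]; the linear version: [cite: ChulaevskySuhov2014, Theorem 2.3.3] (as recorded in ref2 and
in `Beta/CombesThomasForm`).

## NOT certified here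

(i) any bound `J_P` on `defect(∂P∂*)` ((1.126)/(1.127), leaf `B5.Kernel126_127Printed`);
(ii) a concrete admissible weight `ρ` from the block distance on `T₁^{(k)}` — §5 states exactly
what it must satisfy (`1/n`-Lipschitz along fine bonds; oscillation `≤ L` on the stencils
`{(ny + j + te_μ, μ)}`); the chain's `TorusG0Decay.ldist` / `TorusG0DivDecay.edist`, `twt` (on
`Tor (fine (n+1) M)`) are the natural candidates, not adapted here; (iii) the sup-norm / Hölder entries (1.110)–(1.114) of Prop. 1.2 and hence
`B5.Prop12Printed` itself; (iv) anything at `U ≠ 1` (B9); (v) `BetaPertH`, continuum, Clay.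
-/

open scoped BigOperators Matrix ComplexConjugate ComplexOrder Matrix.Norms.L2Operator
open Finset Complex Matrix

namespace Literature.MathematicalPhysics.QuantumFieldTheory.Balaban1983to89.Beta.DeltaACombesThomas

open Literature.MathematicalPhysics.QuantumFieldTheory.Balaban1983to89.B5Prop11Lower (nsq nsq_nonneg
  norm_star_dotProduct_le)

noncomputable section

/-! ## §1 The finite Combes–Thomas bound with the cosh law and PAIRWISE weights (complex Hermitian) -/

section Generic

variable {ι : Type*} [Fintype ι]

/-- the pairwise Combes–Thomas weight `cosh(κ(ρ_e − ρ_{e′})) − 1 ≥ 0` of a pair of indices.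
[folklore] -/
def ctWeight (κ : ℝ) (ρ : ι → ℝ) (e e' : ι) : ℝ := Real.cosh (κ * (ρ e - ρ e')) - 1

omit [Fintype ι] in
/-- `w ≥ 0` (`cosh ≥ 1`). [folklore] -/
theorem ctWeight_nonneg (κ : ℝ) (ρ : ι → ℝ) (e e' : ι) : 0 ≤ ctWeight κ ρ e e' := by
  unfold ctWeight; linarith [Real.one_le_cosh (κ * (ρ e - ρ e'))]

omit [Fintype ι] in
/-- `w(e,e′) = w(e′,e)` (`cosh` is even). [folklore] -/
theorem ctWeight_symm (κ : ℝ) (ρ : ι → ℝ) (e e' : ι) : ctWeight κ ρ e e' = ctWeight κ ρ e' e := by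
  unfold ctWeight
  rw [show κ * (ρ e' - ρ e) = -(κ * (ρ e - ρ e')) by ring, Real.cosh_neg]

omit [Fintype ι] in
/-- `w(e,e) = 0`. [folklore] -/
theorem ctWeight_self (κ : ℝ) (ρ : ι → ℝ) (e : ι) : ctWeight κ ρ e e = 0 := by
  simp [ctWeight]

/-- the ROW DEFECT `Σ_{e′} ‖A(e,e′)‖ (cosh(κ(ρ_e − ρ_{e′})) − 1)` of a kernel `A` at the weight
`ρ` and rate `κ` (the diagonal does not contribute). [folklore] -/
def ctRowDefect (A : Matrix ι ι ℂ) (κ : ℝ) (ρ : ι → ℝ) (e : ι) : ℝ :=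
  ∑ e', ‖A e e'‖ * ctWeight κ ρ e e'

/-- the row defect is nonnegative. [folklore] -/
theorem ctRowDefect_nonneg (A : Matrix ι ι ℂ) (κ : ℝ) (ρ : ι → ℝ) (e : ι) :
    0 ≤ ctRowDefect A κ ρ e :=
  Finset.sum_nonneg fun e' _ => mul_nonneg (norm_nonneg _) (ctWeight_nonneg κ ρ e e')

/-- the row defect is subadditive in the kernel. [folklore] -/
theorem ctRowDefect_add_le (A B : Matrix ι ι ℂ) (κ : ℝ) (ρ : ι → ℝ) (e : ι) :
    ctRowDefect (A + B) κ ρ e ≤ ctRowDefect A κ ρ e + ctRowDefect B κ ρ e := by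
  unfold ctRowDefect
  rw [← Finset.sum_add_distrib]
  refine Finset.sum_le_sum fun e' _ => ?_
  rw [← add_mul, Matrix.add_apply]
  exact mul_le_mul_of_nonneg_right (norm_add_le _ _) (ctWeight_nonneg κ ρ e e')

/-- `defect(−A) = defect(A)`. [folklore] -/
theorem ctRowDefect_neg (A : Matrix ι ι ℂ) (κ : ℝ) (ρ : ι → ℝ) (e : ι) :
    ctRowDefect (-A) κ ρ e = ctRowDefect A κ ρ e := by
  unfold ctRowDefect; simp [norm_neg]

/-- `defect(A − B) ≤ defect(A) + defect(B)`. [folklore] -/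
theorem ctRowDefect_sub_le (A B : Matrix ι ι ℂ) (κ : ℝ) (ρ : ι → ℝ) (e : ι) :
    ctRowDefect (A - B) κ ρ e ≤ ctRowDefect A κ ρ e + ctRowDefect B κ ρ e := by
  rw [sub_eq_add_neg]
  exact (ctRowDefect_add_le A (-B) κ ρ e).trans (by rw [ctRowDefect_neg])

/-- `defect(c•A) = |c|·defect(A)`. [folklore] -/
theorem ctRowDefect_smul (c : ℂ) (A : Matrix ι ι ℂ) (κ : ℝ) (ρ : ι → ℝ) (e : ι) :
    ctRowDefect (c • A) κ ρ e = ‖c‖ * ctRowDefect A κ ρ e := by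
  unfold ctRowDefect
  rw [Finset.mul_sum]
  refine Finset.sum_congr rfl fun e' _ => ?_
  rw [Matrix.smul_apply, smul_eq_mul, norm_mul, mul_assoc]

/-- monotonicity of the row defect under an entrywise domination by a kernel with real
nonnegative... : if `‖A e e′‖ ≤ K e e′` then the defect of `A` is at most the `K`-weighted sum.
[folklore] -/
theorem ctRowDefect_le_of_norm_le (A : Matrix ι ι ℂ) (K : ι → ι → ℝ) (κ : ℝ) (ρ : ι → ℝ) (e : ι)
    (hK : ∀ e', ‖A e e'‖ ≤ K e e') :
    ctRowDefect A κ ρ e ≤ ∑ e', K e e' * ctWeight κ ρ e e' :=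
  Finset.sum_le_sum fun e' _ => mul_le_mul_of_nonneg_right (hK e') (ctWeight_nonneg κ ρ e e')

/-- the COSH SYMMETRISATION: for a Hermitian kernel, the real part of the conjugated form
`Σ_{e,e′} z̄_e e^{κ(ρ_e−ρ_{e′})} A(e,e′) z_{e′}` is the `cosh`-weighted real form. [folklore] -/
theorem re_conjugated_form (A : Matrix ι ι ℂ) (hA : A.IsHermitian) (κ : ℝ) (ρ : ι → ℝ)
    (z : ι → ℂ) :
    (∑ e, ∑ e', (starRingEnd ℂ) (z e) * ((Real.exp (κ * (ρ e - ρ e')) : ℝ) : ℂ) * A e e' * z e').re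
      = ∑ e, ∑ e', ((starRingEnd ℂ) (z e) * A e e' * z e').re * Real.cosh (κ * (ρ e - ρ e')) := by
  -- the real parts of the summands pair up under `e ↔ e′`
  set r : ι → ι → ℝ := fun e e' => ((starRingEnd ℂ) (z e) * A e e' * z e').re with hr
  have hsymm : ∀ e e', r e e' = r e' e := by
    intro e e'
    simp only [hr]
    have h : (starRingEnd ℂ) ((starRingEnd ℂ) (z e) * A e e' * z e')
        = (starRingEnd ℂ) (z e') * A e' e * z e := by
      rw [map_mul, map_mul, Complex.conj_conj]
      have hAe : (starRingEnd ℂ) (A e e') = A e' e := by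
        simpa using hA.apply e' e
      rw [hAe]; ring
    rw [← h, Complex.conj_re]
  have hre : ∀ e e', ((starRingEnd ℂ) (z e) * ((Real.exp (κ * (ρ e - ρ e')) : ℝ) : ℂ) * A e e'
      * z e').re = r e e' * Real.exp (κ * (ρ e - ρ e')) := by
    intro e e'
    have : (starRingEnd ℂ) (z e) * ((Real.exp (κ * (ρ e - ρ e')) : ℝ) : ℂ) * A e e' * z e'
        = ((Real.exp (κ * (ρ e - ρ e')) : ℝ) : ℂ) * ((starRingEnd ℂ) (z e) * A e e' * z e') := by
      ring
    rw [this, Complex.re_ofReal_mul, hr, mul_comm]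
  rw [Complex.re_sum]
  simp_rw [Complex.re_sum, hre]
  -- Σ r e^{κΔ} = Σ r e^{-κΔ} by the swap, hence = Σ r cosh
  have hswap : ∑ e, ∑ e', r e e' * Real.exp (κ * (ρ e - ρ e'))
      = ∑ e, ∑ e', r e e' * Real.exp (-(κ * (ρ e - ρ e'))) := by
    rw [Finset.sum_comm]
    refine Finset.sum_congr rfl fun e _ => Finset.sum_congr rfl fun e' _ => ?_
    rw [hsymm e' e, show -(κ * (ρ e - ρ e')) = κ * (ρ e' - ρ e) by ring]
  have h2 : (∑ e, ∑ e', r e e' * Real.exp (κ * (ρ e - ρ e')))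
      + ∑ e, ∑ e', r e e' * Real.exp (-(κ * (ρ e - ρ e')))
      = 2 * ∑ e, ∑ e', r e e' * Real.cosh (κ * (ρ e - ρ e')) := by
    rw [← Finset.sum_add_distrib, Finset.mul_sum]
    refine Finset.sum_congr rfl fun e _ => ?_
    rw [← Finset.sum_add_distrib, Finset.mul_sum]
    refine Finset.sum_congr rfl fun e' _ => ?_
    rw [Real.cosh_eq]; ring
  linarith

/-- the WEIGHTED COERCIVITY: if `γ‖x‖² ≤ Re x^*Ax` and the row defects at rate `κ` are `≤ J`,
the conjugated form is bounded below by `(γ − J)‖z‖²`. [folklore] -/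
theorem conjugated_form_coercive (A : Matrix ι ι ℂ) (hA : A.IsHermitian) (κ : ℝ) (ρ : ι → ℝ)
    {γ J : ℝ} (hγ : ∀ x : ι → ℂ, γ * nsq x ≤ (star x ⬝ᵥ (A *ᵥ x)).re)
    (hJ : ∀ e, ctRowDefect A κ ρ e ≤ J) (z : ι → ℂ) :
    (γ - J) * nsq z ≤
      (∑ e, ∑ e', (starRingEnd ℂ) (z e) * ((Real.exp (κ * (ρ e - ρ e')) : ℝ) : ℂ) * A e e'
        * z e').re := by
  rw [re_conjugated_form A hA κ ρ z]
  -- split cosh = 1 + (cosh − 1)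
  have hsplit : ∑ e, ∑ e', ((starRingEnd ℂ) (z e) * A e e' * z e').re * Real.cosh (κ * (ρ e - ρ e'))
      = (∑ e, ∑ e', ((starRingEnd ℂ) (z e) * A e e' * z e').re)
        + ∑ e, ∑ e', ((starRingEnd ℂ) (z e) * A e e' * z e').re * ctWeight κ ρ e e' := by
    rw [← Finset.sum_add_distrib]
    refine Finset.sum_congr rfl fun e _ => ?_
    rw [← Finset.sum_add_distrib]
    refine Finset.sum_congr rfl fun e' _ => ?_
    rw [ctWeight]; ring
  -- the unweighted double sum is Re z^* A z
  have hform : (∑ e, ∑ e', ((starRingEnd ℂ) (z e) * A e e' * z e').re)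
      = (star z ⬝ᵥ (A *ᵥ z)).re := by
    rw [dotProduct, Complex.re_sum]
    refine Finset.sum_congr rfl fun e _ => ?_
    rw [Matrix.mulVec, dotProduct, Finset.mul_sum, Complex.re_sum]
    refine Finset.sum_congr rfl fun e' _ => ?_
    rw [Pi.star_apply, Complex.star_def, mul_assoc]
  -- the defect double sum is ≥ −J‖z‖²
  have hdef : -(J * nsq z)
      ≤ ∑ e, ∑ e', ((starRingEnd ℂ) (z e) * A e e' * z e').re * ctWeight κ ρ e e' := by
    have h1 : ∀ e e', -(‖z e‖ * ‖A e e'‖ * ‖z e'‖ * ctWeight κ ρ e e')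
        ≤ ((starRingEnd ℂ) (z e) * A e e' * z e').re * ctWeight κ ρ e e' := by
      intro e e'
      have hw := ctWeight_nonneg κ ρ e e'
      have hre : -(‖z e‖ * ‖A e e'‖ * ‖z e'‖) ≤ ((starRingEnd ℂ) (z e) * A e e' * z e').re := by
        have := (Complex.abs_re_le_norm ((starRingEnd ℂ) (z e) * A e e' * z e'))
        rw [norm_mul, norm_mul, Complex.norm_conj] at this
        linarith [neg_abs_le ((starRingEnd ℂ) (z e) * A e e' * z e').re]
      nlinarith
    -- AM–GM with the symmetric weight: Σ ‖z_e‖‖A‖‖z_e′‖w ≤ Σ ‖z_e‖² ‖A‖ w = Σ_e ‖z_e‖² defect(e)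
    have h2 : ∑ e, ∑ e', ‖z e‖ * ‖A e e'‖ * ‖z e'‖ * ctWeight κ ρ e e'
        ≤ ∑ e, ‖z e‖ ^ 2 * ctRowDefect A κ ρ e := by
      have hamgm : ∑ e, ∑ e', ‖z e‖ * ‖A e e'‖ * ‖z e'‖ * ctWeight κ ρ e e'
          ≤ ∑ e, ∑ e', (‖z e‖ ^ 2 + ‖z e'‖ ^ 2) / 2 * (‖A e e'‖ * ctWeight κ ρ e e') := by
        refine Finset.sum_le_sum fun e _ => Finset.sum_le_sum fun e' _ => ?_
        have hc : 0 ≤ ‖A e e'‖ * ctWeight κ ρ e e' :=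
          mul_nonneg (norm_nonneg _) (ctWeight_nonneg κ ρ e e')
        have : ‖z e‖ * ‖z e'‖ ≤ (‖z e‖ ^ 2 + ‖z e'‖ ^ 2) / 2 := by
          nlinarith [sq_nonneg (‖z e‖ - ‖z e'‖)]
        calc ‖z e‖ * ‖A e e'‖ * ‖z e'‖ * ctWeight κ ρ e e'
            = (‖z e‖ * ‖z e'‖) * (‖A e e'‖ * ctWeight κ ρ e e') := by ring
          _ ≤ (‖z e‖ ^ 2 + ‖z e'‖ ^ 2) / 2 * (‖A e e'‖ * ctWeight κ ρ e e') :=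
            mul_le_mul_of_nonneg_right this hc
      have hsym : ∑ e, ∑ e', ‖z e'‖ ^ 2 / 2 * (‖A e e'‖ * ctWeight κ ρ e e')
          = ∑ e, ∑ e', ‖z e‖ ^ 2 / 2 * (‖A e e'‖ * ctWeight κ ρ e e') := by
        rw [Finset.sum_comm]
        refine Finset.sum_congr rfl fun e _ => Finset.sum_congr rfl fun e' _ => ?_
        rw [ctWeight_symm κ ρ e' e]
        have hAe : ‖A e' e‖ = ‖A e e'‖ := by
          rw [← hA.apply e e']; simp
        rw [hAe]
      calc ∑ e, ∑ e', ‖z e‖ * ‖A e e'‖ * ‖z e'‖ * ctWeight κ ρ e e'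
          ≤ ∑ e, ∑ e', (‖z e‖ ^ 2 + ‖z e'‖ ^ 2) / 2 * (‖A e e'‖ * ctWeight κ ρ e e') := hamgm
        _ = (∑ e, ∑ e', ‖z e‖ ^ 2 / 2 * (‖A e e'‖ * ctWeight κ ρ e e'))
            + ∑ e, ∑ e', ‖z e'‖ ^ 2 / 2 * (‖A e e'‖ * ctWeight κ ρ e e') := by
          rw [← Finset.sum_add_distrib]
          refine Finset.sum_congr rfl fun e _ => ?_
          rw [← Finset.sum_add_distrib]
          refine Finset.sum_congr rfl fun e' _ => ?_
          ring
        _ = ∑ e, ‖z e‖ ^ 2 * ctRowDefect A κ ρ e := by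
          rw [hsym, ← Finset.sum_add_distrib]
          refine Finset.sum_congr rfl fun e _ => ?_
          rw [ctRowDefect, Finset.mul_sum, ← Finset.sum_add_distrib]
          refine Finset.sum_congr rfl fun e' _ => ?_
          ring
    have h3 : ∑ e, ‖z e‖ ^ 2 * ctRowDefect A κ ρ e ≤ J * nsq z := by
      rw [nsq, Finset.mul_sum]
      refine Finset.sum_le_sum fun e _ => ?_
      rw [mul_comm]
      exact mul_le_mul_of_nonneg_right (hJ e) (sq_nonneg _)
    have h4 : -(∑ e, ∑ e', ‖z e‖ * ‖A e e'‖ * ‖z e'‖ * ctWeight κ ρ e e')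
        ≤ ∑ e, ∑ e', ((starRingEnd ℂ) (z e) * A e e' * z e').re * ctWeight κ ρ e e' := by
      rw [← Finset.sum_neg_distrib]
      refine Finset.sum_le_sum fun e _ => ?_
      rw [← Finset.sum_neg_distrib]
      exact Finset.sum_le_sum fun e' _ => h1 e e'
    linarith
  have hγz := hγ z
  rw [hsplit, hform]
  nlinarith [hdef, hγz]

/-- **The finite Combes–Thomas bound with the cosh law and pairwise weights** (complex Hermitian
kernels).  If `γ‖x‖² ≤ Re x^*Ax` for all `x`, the row defects of `A` at rate `κ ≥ 0` and weight `ρ`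
are `≤ J < γ`, `Ax = v` with `v` supported in `{ρ ≤ 0}` and `u` supported in `{R ≤ ρ}`, then
`|u^* x| ≤ e^{−κR}(γ − J)⁻¹ ‖u‖ ‖v‖`.  Nearest tree neighbour: ref2's real, one-Lipschitz-scale
`MassGapFunctionalInequalities.combesThomas_cosh_bound` (`J(cosh κ − 1) < γ` with ONE bound `J` on the
off-diagonal row sums and `|ρ_e − ρ_{e′}| ≤ 1` on the support of `A`); here each entry carries its own
weight `cosh(κ(ρ_e − ρ_{e′})) − 1`, which is what lets entries of very different ranges and sizes
(nearest-neighbour `n²`-entries at `ρ`-distance `1/n`, block-range `n^{-d}`-entries at `ρ`-distance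
`O(1)`, exponentially decaying tails) share ONE `n`-uniform rate. [folklore] -/
theorem combesThomas_pairwise (A : Matrix ι ι ℂ) (hA : A.IsHermitian) (ρ : ι → ℝ) {γ J κ R : ℝ}
    (hγ : ∀ x : ι → ℂ, γ * nsq x ≤ (star x ⬝ᵥ (A *ᵥ x)).re)
    (hJ : ∀ e, ctRowDefect A κ ρ e ≤ J) (hκ : 0 ≤ κ) (hm : J < γ)
    {u v x : ι → ℂ} (hx : A *ᵥ x = v)
    (hu : ∀ e, u e ≠ 0 → R ≤ ρ e) (hv : ∀ e, v e ≠ 0 → ρ e ≤ 0) :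
    ‖star u ⬝ᵥ x‖ ≤ Real.exp (-(κ * R)) / (γ - J) * (Real.sqrt (nsq u) * Real.sqrt (nsq v)) := by
  have hm0 : 0 < γ - J := by linarith
  -- weighted unknown and data
  set z : ι → ℂ := fun e => ((Real.exp (κ * ρ e) : ℝ) : ℂ) * x e with hz
  set w : ι → ℂ := fun e => ((Real.exp (κ * ρ e) : ℝ) : ℂ) * v e with hw
  -- (a) the conjugated equation `Σ_{e′} e^{κ(ρ_e − ρ_{e′})} A(e,e′) z_{e′} = w_e`
  have hconj : ∀ e, ∑ e', ((Real.exp (κ * (ρ e - ρ e')) : ℝ) : ℂ) * A e e' * z e' = w e := by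
    intro e
    have hxe : ∑ e', A e e' * x e' = v e := by
      have := congr_fun hx e
      simpa [Matrix.mulVec, dotProduct] using this
    have : ∀ e', ((Real.exp (κ * (ρ e - ρ e')) : ℝ) : ℂ) * A e e' * z e'
        = ((Real.exp (κ * ρ e) : ℝ) : ℂ) * (A e e' * x e') := by
      intro e'
      simp only [hz]
      rw [show κ * (ρ e - ρ e') = κ * ρ e - κ * ρ e' by ring, Real.exp_sub]
      have hpos : Real.exp (κ * ρ e') ≠ 0 := (Real.exp_pos _).ne'
      push_cast
      field_simp
    simp_rw [this, ← Finset.mul_sum, hxe, hw]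
  -- (b) the conjugated quadratic form is `Σ_e z̄_e w_e = z^* w`
  have hquad : ∑ e, ∑ e', (starRingEnd ℂ) (z e) * ((Real.exp (κ * (ρ e - ρ e')) : ℝ) : ℂ)
      * A e e' * z e' = star z ⬝ᵥ w := by
    rw [dotProduct]
    refine Finset.sum_congr rfl fun e _ => ?_
    rw [← hconj e, Finset.mul_sum, Pi.star_apply, Complex.star_def]
    refine Finset.sum_congr rfl fun e' _ => ?_
    ring
  -- (c) weighted coercivity + Cauchy–Schwarz: `(γ − J)‖z‖² ≤ Re z^* w ≤ ‖z‖ ‖w‖`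
  have hcoer := conjugated_form_coercive A hA κ ρ hγ hJ z
  rw [hquad] at hcoer
  have hCS : (star z ⬝ᵥ w).re ≤ Real.sqrt (nsq z) * Real.sqrt (nsq w) :=
    (Complex.re_le_norm _).trans (norm_star_dotProduct_le z w)
  have hZ0 : 0 ≤ Real.sqrt (nsq z) := Real.sqrt_nonneg _
  -- hence `(γ − J) ‖z‖ ≤ ‖w‖`
  have hzle : (γ - J) * Real.sqrt (nsq z) ≤ Real.sqrt (nsq w) := by
    by_cases hZ : Real.sqrt (nsq z) = 0
    · rw [hZ, mul_zero]; exact Real.sqrt_nonneg _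
    · have hZpos : 0 < Real.sqrt (nsq z) := lt_of_le_of_ne hZ0 (Ne.symm hZ)
      have key : (γ - J) * (Real.sqrt (nsq z) * Real.sqrt (nsq z))
          ≤ Real.sqrt (nsq z) * Real.sqrt (nsq w) := by
        rw [Real.mul_self_sqrt (nsq_nonneg _)]; exact hcoer.trans hCS
      have key' : ((γ - J) * Real.sqrt (nsq z)) * Real.sqrt (nsq z)
          ≤ Real.sqrt (nsq w) * Real.sqrt (nsq z) := by
        calc ((γ - J) * Real.sqrt (nsq z)) * Real.sqrt (nsq z)
            = (γ - J) * (Real.sqrt (nsq z) * Real.sqrt (nsq z)) := by ring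
          _ ≤ Real.sqrt (nsq z) * Real.sqrt (nsq w) := key
          _ = Real.sqrt (nsq w) * Real.sqrt (nsq z) := mul_comm _ _
      exact le_of_mul_le_mul_right key' hZpos
  -- (d) the data weight is `≤ 1` on the support of `v`: `‖w‖ ≤ ‖v‖`
  have hwv : nsq w ≤ nsq v := by
    unfold nsq
    refine Finset.sum_le_sum fun e _ => ?_
    simp only [hw]
    by_cases hve : v e = 0
    · simp [hve]
    · have hexp1 : Real.exp (κ * ρ e) ≤ 1 := by
        rw [Real.exp_le_one_iff]
        exact mul_nonpos_of_nonneg_of_nonpos hκ (hv e hve)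
      have hexp0 : 0 ≤ Real.exp (κ * ρ e) := (Real.exp_pos _).le
      rw [norm_mul, Complex.norm_real, Real.norm_of_nonneg hexp0, mul_pow]
      calc Real.exp (κ * ρ e) ^ 2 * ‖v e‖ ^ 2 ≤ 1 ^ 2 * ‖v e‖ ^ 2 := by gcongr
        _ = ‖v e‖ ^ 2 := by ring
  -- (e) the observable weight is `≤ e^{−κR}` on the support of `u`
  set u' : ι → ℂ := fun e => ((Real.exp (-(κ * ρ e)) : ℝ) : ℂ) * u e with hu'
  have hux : star u ⬝ᵥ x = star u' ⬝ᵥ z := by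
    rw [dotProduct, dotProduct]
    refine Finset.sum_congr rfl fun e _ => ?_
    simp only [hz, hu', Pi.star_apply, Complex.star_def, map_mul, Complex.conj_ofReal]
    rw [Real.exp_neg]
    have hpos : (((Real.exp (κ * ρ e)) : ℝ) : ℂ) ≠ 0 := by
      exact_mod_cast (Real.exp_pos _).ne'
    push_cast
    field_simp
  have hu'le : nsq u' ≤ Real.exp (-(κ * R)) ^ 2 * nsq u := by
    unfold nsq
    rw [Finset.mul_sum]
    refine Finset.sum_le_sum fun e _ => ?_
    simp only [hu']
    by_cases hue : u e = 0
    · simp [hue]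
    · have hexp : Real.exp (-(κ * ρ e)) ≤ Real.exp (-(κ * R)) := by
        rw [Real.exp_le_exp]
        have := hu e hue
        nlinarith
      have hexp0 : 0 ≤ Real.exp (-(κ * ρ e)) := (Real.exp_pos _).le
      rw [norm_mul, Complex.norm_real, Real.norm_of_nonneg hexp0, mul_pow]
      gcongr
  -- (f) assemble
  have hE0 : 0 ≤ Real.exp (-(κ * R)) := (Real.exp_pos _).le
  calc ‖star u ⬝ᵥ x‖ = ‖star u' ⬝ᵥ z‖ := by rw [hux]
    _ ≤ Real.sqrt (nsq u') * Real.sqrt (nsq z) := norm_star_dotProduct_le u' z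
    _ ≤ (Real.exp (-(κ * R)) * Real.sqrt (nsq u)) * (Real.sqrt (nsq w) / (γ - J)) := by
        have h1 : Real.sqrt (nsq u') ≤ Real.exp (-(κ * R)) * Real.sqrt (nsq u) := by
          calc Real.sqrt (nsq u') ≤ Real.sqrt (Real.exp (-(κ * R)) ^ 2 * nsq u) :=
                Real.sqrt_le_sqrt hu'le
            _ = Real.exp (-(κ * R)) * Real.sqrt (nsq u) := by
                rw [Real.sqrt_mul (sq_nonneg _), Real.sqrt_sq hE0]
        have h2 : Real.sqrt (nsq z) ≤ Real.sqrt (nsq w) / (γ - J) := by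
          rw [le_div_iff₀ hm0, mul_comm]; exact hzle
        gcongr
    _ ≤ (Real.exp (-(κ * R)) * Real.sqrt (nsq u)) * (Real.sqrt (nsq v) / (γ - J)) := by
        gcongr
    _ = Real.exp (-(κ * R)) / (γ - J) * (Real.sqrt (nsq u) * Real.sqrt (nsq v)) := by
        field_simp

/-- The same bound read on the INVERSE: for an invertible Hermitian `A` (e.g. positive definite),
`|u^* A⁻¹ v| ≤ e^{−κR}(γ − J)⁻¹‖u‖‖v‖` for `v` supported in `{ρ ≤ 0}`, `u` in `{R ≤ ρ}`. [folklore] -/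
theorem combesThomas_pairwise_inv [DecidableEq ι] (A : Matrix ι ι ℂ) (hA : A.IsHermitian) (hAu : IsUnit A)
    (ρ : ι → ℝ) {γ J κ R : ℝ}
    (hγ : ∀ x : ι → ℂ, γ * nsq x ≤ (star x ⬝ᵥ (A *ᵥ x)).re)
    (hJ : ∀ e, ctRowDefect A κ ρ e ≤ J) (hκ : 0 ≤ κ) (hm : J < γ)
    {u v : ι → ℂ} (hu : ∀ e, u e ≠ 0 → R ≤ ρ e) (hv : ∀ e, v e ≠ 0 → ρ e ≤ 0) :
    ‖star u ⬝ᵥ (A⁻¹ *ᵥ v)‖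
      ≤ Real.exp (-(κ * R)) / (γ - J) * (Real.sqrt (nsq u) * Real.sqrt (nsq v)) := by
  refine combesThomas_pairwise A hA ρ hγ hJ hκ hm ?_ hu hv
  rw [Matrix.mulVec_mulVec, Matrix.mul_nonsing_inv A ((Matrix.isUnit_iff_isUnit_det A).mp hAu),
    Matrix.one_mulVec]

end Generic

/-! ## §2 Bałaban's `Δ_a` (1.69)/(1.73): coercivity in form shape from the KERNEL (1.90), and the
block-to-block form decay of `𝒢 = Δ_a⁻¹` MODULO one named row-defect hypothesis -/

section DeltaA

open Literature.MathematicalPhysics.QuantumFieldTheory.Balaban1983to89.B5Prop11Plancherel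
open Literature.MathematicalPhysics.QuantumFieldTheory.Balaban1983to89.B5Prop11Inverse
open Literature.MathematicalPhysics.QuantumFieldTheory.Balaban1983to89.B5Prop11Lower
open Literature.MathematicalPhysics.QuantumFieldTheory.Balaban1983to89.B5DeltaA169
open Literature.MathematicalPhysics.QuantumFieldTheory.Balaban1983to89.B5Action121 (GradOp)
open Literature.MathematicalPhysics.QuantumFieldTheory.Balaban1983to89.B5Value126 (PcT)
open Literature.MathematicalPhysics.QuantumFieldTheory.Balaban1983to89.B5Block118 (QvOp)

variable {d : ℕ} (n : ℕ) [NeZero n] (hn : 1 ≤ n) (M : Fin d → ℕ) [hM : ∀ μ, NeZero (M μ)]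
  (a : ℝ) (ha : 0 < a)

/-- the coercivity constant `γ = 1/((d+1)·Cst(d,a))` of the kernel version of (1.90)
(`B5DeltaA169.smul_LapOne_le_DeltaA`). [cite: Balaban1984PropagatorsI, Prop. 1.1 (1.90) p.33
(kernel version; constant ours)] -/
def gammaA (d : ℕ) (a : ℝ) : ℝ := 1 / ((d + 1 : ℝ) * Cst d a)

/-- `γ(d,a) > 0`. [folklore] -/
theorem gammaA_pos : 0 < gammaA d a := by
  unfold gammaA
  have := one_le_Cst (d := d) a
  positivity

include hn ha in
/-- **(1.90) in form shape**: `γ‖A‖² ≤ Re A^* Δ_a A` for every vector function `A` on `T_η`,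
`γ = gammaA d a` — uniformly in `η = 1/n` and in the torus `M`.  From the kernel theorems
`B5Prop11Lower.lowerBound_re` / `form_LapOne` (`A^*(Δ+I)A = Σ_α ‖V_α A‖² ≥ ‖A‖²`) and
`B5DeltaA169.calDa_eq_DeltaA`. [cite: Balaban1984PropagatorsI, Prop. 1.1 (1.90) p.33 (kernel
version; proof ours)] -/
theorem re_form_DeltaA_ge (A : Tor (fine n M) × Fin d → ℂ) :
    gammaA d a * nsq A ≤ (star A ⬝ᵥ (DeltaA n M a *ᵥ A)).re := by
  have h := lowerBound_re n hn M a ha A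
  rw [calDa_eq_DeltaA n hn M a ha, form_LapOne, Complex.ofReal_re] at h
  have hle : nsq A ≤ ∑ α, nsq (Vb n M α *ᵥ A) := by
    have h1 : nsq (Vb n M none *ᵥ A) = nsq A := by
      simp [Vb, Matrix.one_mulVec]
    rw [← h1]
    exact Finset.single_le_sum (f := fun α => nsq (Vb n M α *ᵥ A))
      (fun α _ => nsq_nonneg _) (Finset.mem_univ none)
  have hγ : 0 ≤ gammaA d a := (gammaA_pos (d := d) a).le
  calc gammaA d a * nsq A ≤ gammaA d a * ∑ α, nsq (Vb n M α *ᵥ A) :=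
        mul_le_mul_of_nonneg_left hle hγ
    _ ≤ (star A ⬝ᵥ (DeltaA n M a *ᵥ A)).re := by unfold gammaA; exact h

/-- **Block-to-block FORM DECAY of `𝒢 = Δ_a⁻¹` modulo the row defect of `Δ_a`.**  For ANY weight
`ρ` on `T_η × {1..d}` and rate `κ ≥ 0` at which the row defects of `Δ_a` are `≤ J < γ`:
`|u^* 𝒢 v| ≤ e^{−κR}(γ − J)⁻¹ ‖u‖ ‖v‖` whenever `v` is supported in `{ρ ≤ 0}` and `u` in `{R ≤ ρ}`.
The hypothesis `hJ` is the ONE analytic input; its `Δ`-part and `aQ*Q`-part are elementary (§3),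
its `∂P∂*`-part is the kernel decay (1.126) of `∂P∂*` ([B5] p. 38; the tree's named leaf
`B5.Kernel126_127Printed`, NOT discharged here — `P` (1.70) is not a local operator).
[cite: Balaban1984PropagatorsI, Prop. 1.2 (1.110)/(1.114) pp.35–36 (an L²-form shadow; proof
ours, by the Combes–Thomas method, NOT the printed one)] -/
theorem calG_form_decay (ρ : Tor (fine n M) × Fin d → ℝ) {κ J R : ℝ}
    (hJ : ∀ e, ctRowDefect (DeltaA n M a) κ ρ e ≤ J) (hκ : 0 ≤ κ) (hm : J < gammaA d a)
    {u v : Tor (fine n M) × Fin d → ℂ}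
    (hu : ∀ e, u e ≠ 0 → R ≤ ρ e) (hv : ∀ e, v e ≠ 0 → ρ e ≤ 0) :
    ‖star u ⬝ᵥ (calG n hn M a ha *ᵥ v)‖
      ≤ Real.exp (-(κ * R)) / (gammaA d a - J) * (Real.sqrt (nsq u) * Real.sqrt (nsq v)) := by
  rw [calG_eq_DeltaA_inv n hn M a ha]
  exact combesThomas_pairwise_inv (DeltaA n M a) (DeltaA_isHermitian n hn M a ha)
    (isUnit_DeltaA n hn M a ha) ρ (re_form_DeltaA_ge n hn M a ha) hJ hκ hm hu hv

/-- the three-piece splitting of the row defect of `Δ_a = Δ − ∂P∂* + aQ*Q` ((1.69), second form):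
`defect(Δ_a) ≤ defect(Δ) + defect(∂P∂*) + a·defect(Q*Q)`. [cite: Balaban1984PropagatorsI, (1.69)
p.29 (bookkeeping ours)] -/
theorem ctRowDefect_DeltaA_le (ρ : Tor (fine n M) × Fin d → ℝ) (κ : ℝ)
    (e : Tor (fine n M) × Fin d) :
    ctRowDefect (DeltaA n M a) κ ρ e
      ≤ ctRowDefect (Lap n M) κ ρ e
        + ctRowDefect (GradOp (fine n M) (n : ℂ) * PcT n M (n : ℂ) * (GradOp (fine n M) (n : ℂ))ᴴ)
            κ ρ e
        + |a| * ctRowDefect (QvAdj n M * QvOp n M) κ ρ e := by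
  rw [DeltaA]
  refine (ctRowDefect_add_le _ _ κ ρ e).trans ?_
  have h1 := ctRowDefect_sub_le (Lap n M)
    (GradOp (fine n M) (n : ℂ) * PcT n M (n : ℂ) * (GradOp (fine n M) (n : ℂ))ᴴ) κ ρ e
  have h2 : ctRowDefect ((a : ℂ) • (QvAdj n M * QvOp n M)) κ ρ e
      = |a| * ctRowDefect (QvAdj n M * QvOp n M) κ ρ e := by
    rw [ctRowDefect_smul, Complex.norm_real, Real.norm_eq_abs]
  linarith

end DeltaA

/-! ## §3 The elementary pieces of the row defect of `Δ_a`: the Laplacian `Δ = Σ_ν ∇_ν^*∇_ν`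
(nearest neighbours, entries `η⁻² = n²`, `ρ`-distance `ℓ = O(1/n)`) -/

section Laplacian

open Literature.MathematicalPhysics.QuantumFieldTheory.Balaban1983to89.B5Prop11Plancherel
open Literature.MathematicalPhysics.QuantumFieldTheory.Balaban1983to89.B5Prop11Lower

variable {d : ℕ} (N : Fin d → ℕ) [hN : ∀ μ, NeZero (N μ)]

/-- the translation `(x, μ) ↦ (x + e_ν, μ)` of `T × {1..d}` as a bijection. [folklore] -/
def shiftEquiv (ν : Fin d) : (Tor N × Fin d) ≃ (Tor N × Fin d) :=
  Equiv.prodCongr (Equiv.addRight (unitVec N ν)) (Equiv.refl _)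

omit hN in
/-- `τ_ν(x, μ) = (x + e_ν, μ)`. [folklore] -/
@[simp] theorem shiftEquiv_apply (ν : Fin d) (k : Tor N × Fin d) :
    shiftEquiv N ν k = (k.1 + unitVec N ν, k.2) := rfl

omit hN in
/-- `τ_ν⁻¹(x, μ) = (x − e_ν, μ)`. [folklore] -/
@[simp] theorem shiftEquiv_symm_apply (ν : Fin d) (k : Tor N × Fin d) :
    (shiftEquiv N ν).symm k = (k.1 - unitVec N ν, k.2) := by
  rw [Equiv.symm_apply_eq]
  simp [shiftEquiv]

omit hN in
/-- the entries of the translation matrix: `S_ν(k, e) = [e = k + e_ν]`. [folklore] -/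
theorem shiftM_apply (ν : Fin d) (k e : Tor N × Fin d) :
    shiftM N ν k e = if e = shiftEquiv N ν k then 1 else 0 := rfl

omit hN in
/-- entrywise size of the forward difference: `|(∇_ν)(k, e)| ≤ ‖c‖([e = k + e_ν] + [e = k])`.
[folklore] -/
theorem norm_fdiff_apply_le (c : ℂ) (ν : Fin d) (k e : Tor N × Fin d) :
    ‖fdiff N c ν k e‖
      ≤ ‖c‖ * ((if e = shiftEquiv N ν k then 1 else 0) + (if e = k then 1 else 0)) := by
  rw [fdiff, Matrix.smul_apply, Matrix.sub_apply, shiftM_apply, smul_eq_mul, norm_mul]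
  refine mul_le_mul_of_nonneg_left ?_ (norm_nonneg _)
  rw [Matrix.one_apply]
  have ha : ‖(if e = shiftEquiv N ν k then (1 : ℂ) else 0)‖
      = (if e = shiftEquiv N ν k then (1 : ℝ) else 0) := by
    split_ifs <;> simp
  have hb : ‖(if k = e then (1 : ℂ) else 0)‖ = (if e = k then (1 : ℝ) else 0) := by
    by_cases h : k = e
    · rw [if_pos h, if_pos h.symm]; simp
    · have h' : ¬ e = k := fun h'' => h h''.symm
      rw [if_neg h, if_neg h']; simp
  refine (norm_sub_le _ _).trans ?_
  rw [ha, hb]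

variable {N}

/-- `Σ_{e′} [e′ = t] g(e′) = g(t)`. [folklore] -/
theorem sum_ite_eq_mul {ι : Type*} [Fintype ι] [DecidableEq ι] (t : ι) (g : ι → ℝ) :
    ∑ e', (if e' = t then (1 : ℝ) else 0) * g e' = g t := by
  simp [ite_mul]

/-- `Σ_{e′} [t = e′] g(e′) = g(t)`. [folklore] -/
theorem sum_ite_eq_mul' {ι : Type*} [Fintype ι] [DecidableEq ι] (t : ι) (g : ι → ℝ) :
    ∑ e', (if t = e' then (1 : ℝ) else 0) * g e' = g t := by
  simp [ite_mul]

/-- `Σ_k [e = τk] g(k) = g(τ⁻¹e)` for a bijection `τ`. [folklore] -/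
theorem sum_ite_equiv_eq_mul {ι : Type*} [Fintype ι] [DecidableEq ι] (τ : ι ≃ ι) (e : ι)
    (g : ι → ℝ) : ∑ k, (if e = τ k then (1 : ℝ) else 0) * g k = g (τ.symm e) := by
  have : ∀ k, (e = τ k) ↔ (k = τ.symm e) := fun k => by
    rw [Equiv.eq_symm_apply]; exact eq_comm
  simp_rw [this]
  simp [ite_mul]

variable (N)

/-- the weighted row sum of ONE `∇_ν^*∇_ν`: only the two neighbours `e ± e_ν` contribute,
`Σ_{e′} ‖(∇_ν^*∇_ν)(e,e′)‖ w(e,e′) ≤ ‖c‖² (w(e, e − e_ν) + w(e, e + e_ν))` for any nonnegative weight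
vanishing on the diagonal. [folklore] -/
theorem rowSum_fdiffH_fdiff_le (c : ℂ) (ν : Fin d) (w : (Tor N × Fin d) → (Tor N × Fin d) → ℝ)
    (hw : ∀ e e', 0 ≤ w e e') (hw0 : ∀ e, w e e = 0) (e : Tor N × Fin d) :
    ∑ e', ‖((fdiff N c ν)ᴴ * fdiff N c ν) e e'‖ * w e e'
      ≤ ‖c‖ ^ 2 * (w e ((shiftEquiv N ν).symm e) + w e (shiftEquiv N ν e)) := by
  set A : (Tor N × Fin d) → (Tor N × Fin d) → ℝ :=
    fun k e => if e = shiftEquiv N ν k then 1 else 0 with hA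
  set B : (Tor N × Fin d) → (Tor N × Fin d) → ℝ := fun k e => if e = k then 1 else 0 with hB
  -- entrywise: ‖(X^*X)(e,e′)‖ ≤ Σ_k ‖X k e‖ ‖X k e′‖ ≤ ‖c‖² Σ_k (A k e + B k e)(A k e′ + B k e′)
  have hent : ∀ e', ‖((fdiff N c ν)ᴴ * fdiff N c ν) e e'‖
      ≤ ‖c‖ ^ 2 * ∑ k, (A k e + B k e) * (A k e' + B k e') := by
    intro e'
    rw [Matrix.mul_apply]
    refine (norm_sum_le _ _).trans ?_
    rw [Finset.mul_sum]
    refine Finset.sum_le_sum fun k _ => ?_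
    rw [Matrix.conjTranspose_apply, norm_mul, norm_star]
    have h1 := norm_fdiff_apply_le N c ν k e
    have h2 := norm_fdiff_apply_le N c ν k e'
    have hA0 : 0 ≤ A k e + B k e := by
      simp only [hA, hB]; positivity
    calc ‖fdiff N c ν k e‖ * ‖fdiff N c ν k e'‖
        ≤ (‖c‖ * (A k e + B k e)) * (‖c‖ * (A k e' + B k e')) :=
          mul_le_mul h1 h2 (norm_nonneg _) (mul_nonneg (norm_nonneg _) hA0)
      _ = ‖c‖ ^ 2 * ((A k e + B k e) * (A k e' + B k e')) := by ring
  -- sum over e′ with the weight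
  have hstep : ∑ e', ‖((fdiff N c ν)ᴴ * fdiff N c ν) e e'‖ * w e e'
      ≤ ∑ e', (‖c‖ ^ 2 * ∑ k, (A k e + B k e) * (A k e' + B k e')) * w e e' :=
    Finset.sum_le_sum fun e' _ => mul_le_mul_of_nonneg_right (hent e') (hw e e')
  refine hstep.trans (le_of_eq ?_)
  -- evaluate: Σ_{e′} (A k e′ + B k e′) w(e,e′) = w(e, k + e_ν) + w(e, k)
  have hinner : ∀ k, ∑ e', (A k e' + B k e') * w e e' = w e (shiftEquiv N ν k) + w e k := by
    intro k
    simp only [hA, hB, add_mul]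
    rw [Finset.sum_add_distrib, sum_ite_eq_mul, sum_ite_eq_mul]
  calc ∑ e', (‖c‖ ^ 2 * ∑ k, (A k e + B k e) * (A k e' + B k e')) * w e e'
      = ∑ e', ∑ k, ‖c‖ ^ 2 * ((A k e + B k e) * ((A k e' + B k e') * w e e')) := by
        refine Finset.sum_congr rfl fun e' _ => ?_
        rw [Finset.mul_sum, Finset.sum_mul]
        refine Finset.sum_congr rfl fun k _ => ?_
        ring
    _ = ∑ k, ∑ e', ‖c‖ ^ 2 * ((A k e + B k e) * ((A k e' + B k e') * w e e')) := Finset.sum_comm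
    _ = ‖c‖ ^ 2 * ∑ k, (A k e + B k e) * (w e (shiftEquiv N ν k) + w e k) := by
        rw [Finset.mul_sum]
        refine Finset.sum_congr rfl fun k _ => ?_
        rw [← hinner k, Finset.mul_sum, Finset.mul_sum]
    _ = ‖c‖ ^ 2 * (w e ((shiftEquiv N ν).symm e) + w e (shiftEquiv N ν e)) := by
        congr 1
        simp only [hA, hB, add_mul]
        rw [Finset.sum_add_distrib, sum_ite_equiv_eq_mul, sum_ite_eq_mul', Equiv.apply_symm_apply,
          hw0 e]
        ring

variable {N}
variable (n : ℕ) [NeZero n] (M : Fin d → ℕ) [hM : ∀ μ, NeZero (M μ)]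

/-- **Row defect of the Laplacian.**  If the weight `ρ` is `ℓ`-Lipschitz along the fine bonds,
`|ρ(x + e_ν, μ) − ρ(x, μ)| ≤ ℓ`, then `defect_{κ,ρ}(Δ)(e) ≤ 2d·n²·(cosh(κℓ) − 1)` at every row `e`
(`Δ = Σ_ν ∇_ν^*∇_ν`, `∇_ν = n(S_ν − 1)`): uniformly in the torus. [folklore] -/
theorem ctRowDefect_Lap_le (ρ : Tor (fine n M) × Fin d → ℝ) {κ ℓ : ℝ}
    (hℓ : ∀ (x : Tor (fine n M)) (μ : Fin d) (ν : Fin d),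
      |ρ (x + unitVec (fine n M) ν, μ) - ρ (x, μ)| ≤ ℓ)
    (e : Tor (fine n M) × Fin d) :
    ctRowDefect (Lap n M) κ ρ e ≤ 2 * d * (n : ℝ) ^ 2 * (Real.cosh (κ * ℓ) - 1) := by
  -- the weight and its two values at the neighbours
  have hwle : ∀ ν, ctWeight κ ρ e ((shiftEquiv (fine n M) ν).symm e) ≤ Real.cosh (κ * ℓ) - 1 ∧
      ctWeight κ ρ e (shiftEquiv (fine n M) ν e) ≤ Real.cosh (κ * ℓ) - 1 := by
    intro ν
    have key : ∀ t : ℝ, |t| ≤ ℓ → Real.cosh (κ * t) - 1 ≤ Real.cosh (κ * ℓ) - 1 := by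
      intro t ht
      have : Real.cosh (κ * t) ≤ Real.cosh (κ * ℓ) := by
        rw [Real.cosh_le_cosh, abs_mul, abs_mul]
        exact mul_le_mul_of_nonneg_left (ht.trans (le_abs_self ℓ)) (abs_nonneg κ)
      linarith
    constructor
    · rw [ctWeight, shiftEquiv_symm_apply]
      apply key
      have h := hℓ (e.1 - unitVec (fine n M) ν) e.2 ν
      rw [sub_add_cancel] at h
      simpa using h
    · rw [ctWeight, shiftEquiv_apply]
      apply key
      have h := hℓ e.1 e.2 ν
      rw [abs_sub_comm]
      simpa using h
  -- split the sum over ν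
  have hsplit : ctRowDefect (Lap n M) κ ρ e
      ≤ ∑ ν : Fin d, ∑ e', ‖((fdiff (fine n M) (n : ℂ) ν)ᴴ * fdiff (fine n M) (n : ℂ) ν) e e'‖
          * ctWeight κ ρ e e' := by
    rw [ctRowDefect, Finset.sum_comm]
    refine Finset.sum_le_sum fun e' _ => ?_
    rw [← Finset.sum_mul]
    refine mul_le_mul_of_nonneg_right ?_ (ctWeight_nonneg κ ρ e e')
    rw [Lap, Matrix.sum_apply]
    exact norm_sum_le _ _
  refine hsplit.trans ?_
  have hν : ∀ ν : Fin d, ∑ e', ‖((fdiff (fine n M) (n : ℂ) ν)ᴴ * fdiff (fine n M) (n : ℂ) ν) e e'‖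
      * ctWeight κ ρ e e' ≤ (n : ℝ) ^ 2 * (2 * (Real.cosh (κ * ℓ) - 1)) := by
    intro ν
    have h := rowSum_fdiffH_fdiff_le (fine n M) (n : ℂ) ν (ctWeight κ ρ) (ctWeight_nonneg κ ρ)
      (ctWeight_self κ ρ) e
    rw [Complex.norm_natCast] at h
    refine h.trans ?_
    have := hwle ν
    nlinarith [this.1, this.2, sq_nonneg (n : ℝ)]
  calc ∑ ν : Fin d, ∑ e', ‖((fdiff (fine n M) (n : ℂ) ν)ᴴ * fdiff (fine n M) (n : ℂ) ν) e e'‖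
          * ctWeight κ ρ e e'
      ≤ ∑ _ν : Fin d, (n : ℝ) ^ 2 * (2 * (Real.cosh (κ * ℓ) - 1)) := Finset.sum_le_sum fun ν _ => hν ν
    _ = 2 * d * (n : ℝ) ^ 2 * (Real.cosh (κ * ℓ) - 1) := by
        rw [Finset.sum_const, Finset.card_univ, Fintype.card_fin, nsmul_eq_mul]; ring

omit [NeZero n] in
/-- the `n`-UNIFORMITY of the Laplacian defect at the natural Lipschitz scale `ℓ = 1/n`:
`n²(cosh(κ/n) − 1) ≤ (κ²/2)e^{κ²/2}` for `n ≥ 1` (from `cosh x ≤ e^{x²/2}` and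
`e^y − 1 ≤ y e^y`). [folklore] -/
theorem sq_mul_cosh_div_sub_one_le (κ : ℝ) (hn : 1 ≤ n) :
    (n : ℝ) ^ 2 * (Real.cosh (κ / n) - 1) ≤ κ ^ 2 / 2 * Real.exp (κ ^ 2 / 2) := by
  have hn0 : (0 : ℝ) < n := by exact_mod_cast hn
  have hn1 : (1 : ℝ) ≤ n := by exact_mod_cast hn
  set y : ℝ := (κ / n) ^ 2 / 2 with hy
  have hy0 : 0 ≤ y := by positivity
  -- cosh(κ/n) − 1 ≤ e^y − 1 ≤ y e^y
  have h1 : Real.cosh (κ / n) - 1 ≤ Real.exp y - 1 := by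
    linarith [Real.cosh_le_exp_half_sq (κ / n)]
  have h2 : Real.exp y - 1 ≤ y * Real.exp y := by
    have := Real.add_one_le_exp (-y)
    have hpos := Real.exp_pos y
    have hprod : Real.exp (-y) * Real.exp y = 1 := by rw [← Real.exp_add]; simp
    nlinarith
  -- y e^y ≤ (κ²/(2n²)) e^{κ²/2}
  have hyle : y ≤ κ ^ 2 / 2 := by
    rw [hy, div_pow]
    have hn2 : (1 : ℝ) ≤ (n : ℝ) ^ 2 := by nlinarith
    have : κ ^ 2 / (n : ℝ) ^ 2 ≤ κ ^ 2 := by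
      rw [div_le_iff₀ (by positivity)]
      nlinarith [mul_le_mul_of_nonneg_left hn2 (sq_nonneg κ)]
    linarith
  have h3 : y * Real.exp y ≤ y * Real.exp (κ ^ 2 / 2) :=
    mul_le_mul_of_nonneg_left (Real.exp_le_exp.mpr hyle) hy0
  have hyn : (n : ℝ) ^ 2 * y = κ ^ 2 / 2 := by
    rw [hy]; field_simp
  calc (n : ℝ) ^ 2 * (Real.cosh (κ / n) - 1) ≤ (n : ℝ) ^ 2 * (y * Real.exp (κ ^ 2 / 2)) := by
        exact mul_le_mul_of_nonneg_left ((h1.trans h2).trans h3) (by positivity)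
    _ = κ ^ 2 / 2 * Real.exp (κ ^ 2 / 2) := by rw [← mul_assoc, hyn]

/-- **Row defect of the Laplacian, `n`-uniform form**: for a weight `1/n`-Lipschitz along the fine
bonds (a weight measured in BLOCK units, `η = 1/n`), `defect_{κ,ρ}(Δ)(e) ≤ d κ² e^{κ²/2}`, free of
`n` and of the torus. [folklore] -/
theorem ctRowDefect_Lap_le_uniform (hn : 1 ≤ n) (ρ : Tor (fine n M) × Fin d → ℝ) {κ : ℝ}
    (hℓ : ∀ (x : Tor (fine n M)) (μ : Fin d) (ν : Fin d),
      |ρ (x + unitVec (fine n M) ν, μ) - ρ (x, μ)| ≤ 1 / n)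
    (e : Tor (fine n M) × Fin d) :
    ctRowDefect (Lap n M) κ ρ e ≤ d * κ ^ 2 * Real.exp (κ ^ 2 / 2) := by
  have h := ctRowDefect_Lap_le n M ρ (κ := κ) hℓ e
  rw [show κ * (1 / (n : ℝ)) = κ / n by ring] at h
  have h2 := sq_mul_cosh_div_sub_one_le n κ hn
  have hd : (0 : ℝ) ≤ d := Nat.cast_nonneg d
  nlinarith

end Laplacian

/-! ## §4 The elementary pieces of the row defect of `Δ_a`: the block-averaging term `a Q_k^* Q_k`
((1.18): `Q_k` averages over the `n^d·n` bonds `[x, x + e_μ]`, `x ∈ B^k(y)` shifted along `μ`;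
row sums of `|Q_k|` are `1`, column sums `n^{-d}`, and `Q_k^*` carries `η^{-d} = n^d`) -/

section BlockAverage

open Literature.MathematicalPhysics.QuantumFieldTheory.Balaban1983to89.B5Prop11Plancherel
open Literature.MathematicalPhysics.QuantumFieldTheory.Balaban1983to89.B5Prop11Lower
open Literature.MathematicalPhysics.QuantumFieldTheory.Balaban1983to89.B5Block118
open Literature.MathematicalPhysics.QuantumFieldTheory.Balaban1983to89.B5Blocks16
open Literature.MathematicalPhysics.QuantumFieldTheory.Balaban1983to89.B5DeltaA169

variable {d : ℕ} (n : ℕ) [NeZero n] (M : Fin d → ℕ) [hM : ∀ μ, NeZero (M μ)]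

/-- the modulus of the entries of `Q_k` (1.18), as a real kernel: `η^{d+1}` times the number of
pairs `(j, t)` with `i = (n y + j + t e_μ, μ)`, `b = (y, μ)`. [cite: Balaban1984PropagatorsI, (1.18) p.20] -/
def qr (b : Tor M × Fin d) (i : Tor (fine n M) × Fin d) : ℝ :=
  ∑ j : Fin d → Fin n, ∑ t : Fin n,
    (if i = (bpt n M b.1 j + tstep (fine n M) b.2 t, b.2) then 1 / (n : ℝ) ^ (d + 1) else 0)

omit [NeZero n] hM in
/-- `qr ≥ 0`. [folklore] -/
theorem qr_nonneg (b : Tor M × Fin d) (i : Tor (fine n M) × Fin d) : 0 ≤ qr n M b i :=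
  Finset.sum_nonneg fun _ _ => Finset.sum_nonneg fun _ _ => by split_ifs <;> positivity

omit [NeZero n] hM in
/-- `|Q_k(b, i)| ≤ qr(b, i)` (in fact equality). [cite: Balaban1984PropagatorsI, (1.18) p.20] -/
theorem norm_QvOp_le (b : Tor M × Fin d) (i : Tor (fine n M) × Fin d) :
    ‖QvOp n M b i‖ ≤ qr n M b i := by
  by_cases h : i.2 = b.2
  · have hQ : QvOp n M b i = ∑ j : Fin d → Fin n, ∑ t : Fin n,
        (if i.1 = bpt n M b.1 j + tstep (fine n M) b.2 t then 1 / (n : ℂ) ^ (d + 1) else 0) := by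
      simp only [QvOp, if_pos h]
    rw [hQ, qr]
    refine (norm_sum_le _ _).trans (Finset.sum_le_sum fun j _ =>
      (norm_sum_le _ _).trans (Finset.sum_le_sum fun t _ => ?_))
    have hiff : i = (bpt n M b.1 j + tstep (fine n M) b.2 t, b.2)
        ↔ i.1 = bpt n M b.1 j + tstep (fine n M) b.2 t := by
      constructor
      · intro hi; rw [hi]
      · intro hi; exact Prod.ext hi h
    by_cases hc : i.1 = bpt n M b.1 j + tstep (fine n M) b.2 t
    · rw [if_pos hc, if_pos (hiff.mpr hc)]
      simp
    · rw [if_neg hc, if_neg (fun h' => hc (hiff.mp h'))]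
      simp
  · have hQ : QvOp n M b i = 0 := by simp only [QvOp, if_neg h]
    rw [hQ, norm_zero]
    exact qr_nonneg n M b i

omit [NeZero n] hM in
/-- the support of `Q_k(b, ·)`: the bonds `[x, x + e_μ]`, `x ∈ B^k(y) + t e_μ`, `0 ≤ t < n`.
[cite: Balaban1984PropagatorsI, (1.18) p.20] -/
theorem qr_ne_zero (b : Tor M × Fin d) (i : Tor (fine n M) × Fin d) (h : qr n M b i ≠ 0) :
    ∃ (j : Fin d → Fin n) (t : Fin n), i = (bpt n M b.1 j + tstep (fine n M) b.2 t, b.2) := by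
  by_contra hne
  simp only [not_exists] at hne
  exact h (Finset.sum_eq_zero fun j _ => Finset.sum_eq_zero fun t _ => if_neg (hne j t))

/-- ROW SUMS of `|Q_k|`: `Σ_i |Q_k(b, i)| = η^{d+1}·(n^d·n) = 1`. [cite: Balaban1984PropagatorsI, (1.18) p.20] -/
theorem sum_qr_row (b : Tor M × Fin d) : ∑ i, qr n M b i = 1 := by
  have hn : (n : ℝ) ≠ 0 := by exact_mod_cast NeZero.ne n
  calc ∑ i, qr n M b i
      = ∑ j : Fin d → Fin n, ∑ t : Fin n, ∑ i : Tor (fine n M) × Fin d,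
          (if i = (bpt n M b.1 j + tstep (fine n M) b.2 t, b.2) then 1 / (n : ℝ) ^ (d + 1)
            else 0) := by
        simp only [qr]
        rw [Finset.sum_comm]
        refine Finset.sum_congr rfl fun j _ => ?_
        rw [Finset.sum_comm]
    _ = ∑ _j : Fin d → Fin n, ∑ _t : Fin n, 1 / (n : ℝ) ^ (d + 1) := by
        simp only [Finset.sum_ite_eq', Finset.mem_univ, if_true]
    _ = 1 := by
        rw [Finset.sum_const, Finset.sum_const, Finset.card_univ, Finset.card_univ,
          Fintype.card_fin, Fintype.card_fun, Fintype.card_fin, Fintype.card_fin, nsmul_eq_mul,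
          nsmul_eq_mul]
        push_cast
        field_simp
        ring

/-- for a fixed shift `s`, exactly one pair `(y, j)` has `n y + j = x − s` ((1.6): the blocks
partition `T_η`). [cite: Balaban1984PropagatorsI, (1.6) p.18] -/
theorem sum_blocks_ite (x s : Tor (fine n M)) (c : ℝ) :
    ∑ y : Tor M, ∑ j : Fin d → Fin n, (if x = bpt n M y j + s then c else 0) = c := by
  set E := Equiv.ofBijective _ (bpt_bijective n M) with hE
  have hiff : ∀ (y : Tor M) (j : Fin d → Fin n),
      (x = bpt n M y j + s) ↔ ((y, j) = E.symm (x - s)) := by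
    intro y j
    rw [Equiv.eq_symm_apply, hE, Equiv.ofBijective_apply]
    constructor
    · intro h; rw [h, add_sub_cancel_right]
    · intro h; rw [h, sub_add_cancel]
  simp_rw [hiff]
  have hx : (∑ p : Tor M × (Fin d → Fin n), if p = E.symm (x - s) then c else 0)
      = ∑ y : Tor M, ∑ j : Fin d → Fin n, if (y, j) = E.symm (x - s) then c else 0 := by
    rw [Fintype.sum_prod_type (f := fun p : Tor M × (Fin d → Fin n) =>
      if p = E.symm (x - s) then c else 0)]
  rw [← hx]
  simp only [Finset.sum_ite_eq', Finset.mem_univ, if_true]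

/-- COLUMN SUMS of `|Q_k|`: `Σ_b |Q_k(b, i)| = η^{d+1}·n = η^d = n^{-d}` (every bond lies on exactly
`n` of the straight contours). [cite: Balaban1984PropagatorsI, (1.18) p.20] -/
theorem sum_qr_col (i : Tor (fine n M) × Fin d) : ∑ b, qr n M b i = 1 / (n : ℝ) ^ d := by
  have hn : (n : ℝ) ≠ 0 := by exact_mod_cast NeZero.ne n
  -- the sum over μ collapses to μ = i.2
  have hμ : ∀ (y : Tor M) (j : Fin d → Fin n) (t : Fin n),
      ∑ μ : Fin d, (if i = (bpt n M y j + tstep (fine n M) μ t, μ) then 1 / (n : ℝ) ^ (d + 1)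
        else 0)
        = if i.1 = bpt n M y j + tstep (fine n M) i.2 t then 1 / (n : ℝ) ^ (d + 1) else 0 := by
    intro y j t
    rw [Finset.sum_eq_single i.2]
    · congr 1
      refine propext ⟨fun h => ?_, fun h => Prod.ext h rfl⟩
      exact (congrArg Prod.fst h)
    · intro μ _ hμ
      rw [if_neg]
      intro h
      exact hμ (congrArg Prod.snd h).symm
    · intro h; exact absurd (Finset.mem_univ _) h
  calc ∑ b, qr n M b i
      = ∑ y : Tor M, ∑ μ : Fin d, ∑ j : Fin d → Fin n, ∑ t : Fin n,
          (if i = (bpt n M y j + tstep (fine n M) μ t, μ) then 1 / (n : ℝ) ^ (d + 1) else 0) := by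
        rw [Fintype.sum_prod_type (f := fun b => qr n M b i)]
        simp only [qr]
    _ = ∑ y : Tor M, ∑ j : Fin d → Fin n, ∑ t : Fin n, ∑ μ : Fin d,
          (if i = (bpt n M y j + tstep (fine n M) μ t, μ) then 1 / (n : ℝ) ^ (d + 1) else 0) := by
        refine Finset.sum_congr rfl fun y _ => ?_
        rw [Finset.sum_comm]
        refine Finset.sum_congr rfl fun j _ => ?_
        rw [Finset.sum_comm]
    _ = ∑ t : Fin n, ∑ y : Tor M, ∑ j : Fin d → Fin n,
          (if i.1 = bpt n M y j + tstep (fine n M) i.2 t then 1 / (n : ℝ) ^ (d + 1) else 0) := by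
        simp_rw [hμ]
        symm
        rw [Finset.sum_comm]
        refine Finset.sum_congr rfl fun y _ => ?_
        rw [Finset.sum_comm]
    _ = ∑ _t : Fin n, 1 / (n : ℝ) ^ (d + 1) := by
        refine Finset.sum_congr rfl fun t _ => ?_
        exact sum_blocks_ite n M i.1 _ _
    _ = 1 / (n : ℝ) ^ d := by
        rw [Finset.sum_const, Finset.card_univ, Fintype.card_fin, nsmul_eq_mul]
        field_simp
        ring

omit [NeZero n] in
/-- entrywise: `|(Q_k^*Q_k)(i, i′)| ≤ Σ_b qr(b,i) qr(b,i′)` (before the factor `n^d` of `Q_k^*`).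
[cite: Balaban1984PropagatorsI, (1.18) p.20] -/
theorem norm_QvOpH_QvOp_le (i i' : Tor (fine n M) × Fin d) :
    ‖((QvOp n M)ᴴ * QvOp n M) i i'‖ ≤ ∑ b, qr n M b i * qr n M b i' := by
  rw [Matrix.mul_apply]
  refine (norm_sum_le _ _).trans (Finset.sum_le_sum fun b _ => ?_)
  rw [Matrix.conjTranspose_apply, norm_mul, norm_star]
  exact mul_le_mul (norm_QvOp_le n M b i) (norm_QvOp_le n M b i') (norm_nonneg _)
    (qr_nonneg n M b i)

/-- **Row defect of `Q_k^*Q_k`.**  If the weight `ρ` oscillates by at most `L` over each extended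
block stencil `{(n y + j + t e_μ, μ) : j ∈ {0..n−1}^d, 0 ≤ t < n}` (a set of `ρ`-diameter `O(1)` in
block units), then `defect_{κ,ρ}(Q_k^*Q_k)(i) ≤ cosh(κL) − 1` at every row: the factor `n^d` of
`Q_k^*` (B5DeltaA169 `QvAdj`) is exactly compensated by the column sums `n^{-d}`; free of `n` and
of the torus. [folklore] -/
theorem ctRowDefect_QvAdj_QvOp_le (ρ : Tor (fine n M) × Fin d → ℝ) {κ L : ℝ}
    (hL : ∀ (y : Tor M) (μ : Fin d) (j j' : Fin d → Fin n) (t t' : Fin n),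
      |ρ (bpt n M y j + tstep (fine n M) μ t, μ) - ρ (bpt n M y j' + tstep (fine n M) μ t', μ)|
        ≤ L)
    (i : Tor (fine n M) × Fin d) :
    ctRowDefect (QvAdj n M * QvOp n M) κ ρ i ≤ Real.cosh (κ * L) - 1 := by
  set W := Real.cosh (κ * L) - 1 with hWdef
  have hn : (n : ℝ) ≠ 0 := by exact_mod_cast NeZero.ne n
  have hnd : (0 : ℝ) < (n : ℝ) ^ d := by positivity
  -- on the joint support of `qr(b, i)`, `qr(b, i′)` the weight is at most `W`
  have hw : ∀ b i', qr n M b i ≠ 0 → qr n M b i' ≠ 0 → ctWeight κ ρ i i' ≤ W := by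
    intro b i' h h'
    obtain ⟨j, t, hi⟩ := qr_ne_zero n M b i h
    obtain ⟨j', t', hi'⟩ := qr_ne_zero n M b i' h'
    rw [ctWeight, hi, hi']
    have hcosh : Real.cosh (κ * (ρ (bpt n M b.1 j + tstep (fine n M) b.2 t, b.2)
        - ρ (bpt n M b.1 j' + tstep (fine n M) b.2 t', b.2))) ≤ Real.cosh (κ * L) := by
      rw [Real.cosh_le_cosh, abs_mul, abs_mul]
      exact mul_le_mul_of_nonneg_left ((hL b.1 b.2 j j' t t').trans (le_abs_self L))
        (abs_nonneg κ)
    linarith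
  have hterm : ∀ b i', qr n M b i * qr n M b i' * ctWeight κ ρ i i'
      ≤ qr n M b i * qr n M b i' * W := by
    intro b i'
    by_cases h : qr n M b i = 0
    · rw [h]; simp
    by_cases h' : qr n M b i' = 0
    · rw [h']; simp
    exact mul_le_mul_of_nonneg_left (hw b i' h h') (mul_nonneg (qr_nonneg n M b i)
      (qr_nonneg n M b i'))
  -- the factor `n^d` and the entry bound
  have hentry : ∀ i', ‖(QvAdj n M * QvOp n M) i i'‖
      ≤ (n : ℝ) ^ d * ∑ b, qr n M b i * qr n M b i' := by
    intro i'
    rw [QvAdj, Matrix.smul_mul, Matrix.smul_apply, smul_eq_mul, norm_mul, norm_pow,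
      Complex.norm_natCast]
    exact mul_le_mul_of_nonneg_left (norm_QvOpH_QvOp_le n M i i') hnd.le
  calc ctRowDefect (QvAdj n M * QvOp n M) κ ρ i
      ≤ ∑ i', ((n : ℝ) ^ d * ∑ b, qr n M b i * qr n M b i') * ctWeight κ ρ i i' :=
        Finset.sum_le_sum fun i' _ =>
          mul_le_mul_of_nonneg_right (hentry i') (ctWeight_nonneg κ ρ i i')
    _ = (n : ℝ) ^ d * ∑ i', ∑ b, qr n M b i * qr n M b i' * ctWeight κ ρ i i' := by
        rw [Finset.mul_sum]
        refine Finset.sum_congr rfl fun i' _ => ?_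
        rw [mul_assoc, Finset.sum_mul]
    _ ≤ (n : ℝ) ^ d * ∑ i', ∑ b, qr n M b i * qr n M b i' * W := by
        refine mul_le_mul_of_nonneg_left ?_ hnd.le
        exact Finset.sum_le_sum fun i' _ => Finset.sum_le_sum fun b _ => hterm b i'
    _ = (n : ℝ) ^ d * W * ∑ b, qr n M b i * ∑ i', qr n M b i' := by
        have hre : ∑ i', ∑ b, qr n M b i * qr n M b i' * W
            = ∑ b, ∑ i', W * (qr n M b i * qr n M b i') := by
          rw [Finset.sum_comm]
          refine Finset.sum_congr rfl fun b _ => Finset.sum_congr rfl fun i' _ => ?_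
          ring
        rw [hre]
        simp only [Finset.mul_sum]
        refine Finset.sum_congr rfl fun b _ => Finset.sum_congr rfl fun i' _ => ?_
        ring
    _ = W := by
        simp_rw [sum_qr_row, mul_one]
        rw [sum_qr_col]
        field_simp

end BlockAverage

/-! ## §5 Assembly: the row defect of `Δ_a` and the form decay of `𝒢(a)`, MODULO the row defect of
the `∂P∂*` piece — which is the content of (1.126) p.38 («Let us write bounds for the operator
∂P∂* …»), a named α-leaf of the tree (`B5.Kernel126_127Printed`), NOT discharged here -/

section Assembly

open Literature.MathematicalPhysics.QuantumFieldTheory.Balaban1983to89.B5Prop11Plancherel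
open Literature.MathematicalPhysics.QuantumFieldTheory.Balaban1983to89.B5Prop11Inverse
open Literature.MathematicalPhysics.QuantumFieldTheory.Balaban1983to89.B5Prop11Lower
open Literature.MathematicalPhysics.QuantumFieldTheory.Balaban1983to89.B5DeltaA169
open Literature.MathematicalPhysics.QuantumFieldTheory.Balaban1983to89.B5Action121 (GradOp)
open Literature.MathematicalPhysics.QuantumFieldTheory.Balaban1983to89.B5Value126 (PcT)
open Literature.MathematicalPhysics.QuantumFieldTheory.Balaban1983to89.B5Block118 (QvOp bpt tstep)

variable {d : ℕ} (n : ℕ) [NeZero n] (hn : 1 ≤ n) (M : Fin d → ℕ) [hM : ∀ μ, NeZero (M μ)]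
  (a : ℝ) (ha : 0 < a)

/-- the `n`-free part of the defect budget: Laplacian + block average. [folklore] -/
def defectBudget (d : ℕ) (a κ L : ℝ) : ℝ :=
  d * κ ^ 2 * Real.exp (κ ^ 2 / 2) + |a| * (Real.cosh (κ * L) - 1)

/-- the budget vanishes at `κ = 0` (so for every `J_P < γ` SOME `κ > 0` is admissible as soon as
`J_P(κ) → J_P(0) < γ`; the quantitative choice of `κ` is the consumer's). [folklore] -/
theorem defectBudget_zero (d : ℕ) (a L : ℝ) : defectBudget d a 0 L = 0 := by
  simp [defectBudget]

include hn in
/-- **Row defect of `Δ_a`, assembled** ((1.69) second form): for a weight `ρ` that is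
`1/n`-Lipschitz along fine bonds and oscillates by `≤ L` on the extended block stencils, and ANY
bound `J_P` on the row defect of the `∂P∂*` piece,
`defect_{κ,ρ}(Δ_a)(e) ≤ dκ²e^{κ²/2} + |a|(cosh κL − 1) + J_P`, uniformly in `e`, `n` and the torus.
[cite: Balaban1984PropagatorsI, (1.69) p.29; the `∂P∂*` piece = the content of (1.126) p.38,
kept as the hypothesis `hP`] -/
theorem ctRowDefect_DeltaA_le_of_pieces (ρ : Tor (fine n M) × Fin d → ℝ) {κ L JP : ℝ}
    (hℓ : ∀ (x : Tor (fine n M)) (μ : Fin d) (ν : Fin d),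
      |ρ (x + unitVec (fine n M) ν, μ) - ρ (x, μ)| ≤ 1 / n)
    (hL : ∀ (y : Tor M) (μ : Fin d) (j j' : Fin d → Fin n) (t t' : Fin n),
      |ρ (bpt n M y j + tstep (fine n M) μ t, μ) - ρ (bpt n M y j' + tstep (fine n M) μ t', μ)|
        ≤ L)
    (hP : ∀ e, ctRowDefect
      (GradOp (fine n M) (n : ℂ) * PcT n M (n : ℂ) * (GradOp (fine n M) (n : ℂ))ᴴ) κ ρ e ≤ JP)
    (e : Tor (fine n M) × Fin d) :
    ctRowDefect (DeltaA n M a) κ ρ e ≤ defectBudget d a κ L + JP := by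
  have h1 := ctRowDefect_DeltaA_le n M a ρ κ e
  have h2 := ctRowDefect_Lap_le_uniform n M hn ρ (κ := κ) hℓ e
  have h3 := ctRowDefect_QvAdj_QvOp_le n M ρ (κ := κ) hL e
  have h4 := hP e
  have h5 : |a| * ctRowDefect (QvAdj n M * QvOp n M) κ ρ e ≤ |a| * (Real.cosh (κ * L) - 1) :=
    mul_le_mul_of_nonneg_left h3 (abs_nonneg a)
  rw [defectBudget]
  linarith

/-- **Form decay of `𝒢(a) = Δ_a⁻¹` modulo (1.126)** — the deliverable of this file.  Under the two
geometric hypotheses on the weight `ρ` (fine-Lipschitz `1/n`, stencil oscillation `L`), a bound `J_P`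
on the row defect of `∂P∂*`, and the smallness `dκ²e^{κ²/2} + |a|(cosh κL − 1) + J_P < γ(d,a)`:
for `u` supported in `{ρ ≥ R}` and `v` in `{ρ ≤ 0}`,
`|⟨u, 𝒢(a) v⟩| ≤ e^{−κR}/(γ − budget − J_P)·‖u‖‖v‖` — every constant free of `n = L^k` and of the
torus `T_η`; `κ, L, J_P` are the consumer's.  What is NOT here: (i) the bound `J_P` itself
((1.126)/(1.127) p.38, leaf `B5.Kernel126_127Printed`); (ii) a concrete admissible `ρ` built from
the block distance of `T₁^{(k)}` (geometry; the hypotheses `hℓ`, `hL` are what it must satisfy);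
(iii) the passage from this L²-form decay to the printed sup-norm kernel bound (1.110) with Hölder
norms (1.114) (parametrix/duality, later).  [cite: Balaban1984PropagatorsI, Prop. 1.2 (1.110)
pp.35–36 — an L²-form shadow, proof by the Combes–Thomas method (ours, not the printed one)] -/
theorem calG_form_decay_of_pieces (ρ : Tor (fine n M) × Fin d → ℝ) {κ L JP R : ℝ} (hκ : 0 ≤ κ)
    (hℓ : ∀ (x : Tor (fine n M)) (μ : Fin d) (ν : Fin d),
      |ρ (x + unitVec (fine n M) ν, μ) - ρ (x, μ)| ≤ 1 / n)
    (hL : ∀ (y : Tor M) (μ : Fin d) (j j' : Fin d → Fin n) (t t' : Fin n),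
      |ρ (bpt n M y j + tstep (fine n M) μ t, μ) - ρ (bpt n M y j' + tstep (fine n M) μ t', μ)|
        ≤ L)
    (hP : ∀ e, ctRowDefect
      (GradOp (fine n M) (n : ℂ) * PcT n M (n : ℂ) * (GradOp (fine n M) (n : ℂ))ᴴ) κ ρ e ≤ JP)
    (hm : defectBudget d a κ L + JP < gammaA d a)
    {u v : Tor (fine n M) × Fin d → ℂ}
    (hu : ∀ e, u e ≠ 0 → R ≤ ρ e) (hv : ∀ e, v e ≠ 0 → ρ e ≤ 0) :
    ‖star u ⬝ᵥ (calG n hn M a ha *ᵥ v)‖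
      ≤ Real.exp (-(κ * R)) / (gammaA d a - (defectBudget d a κ L + JP))
          * (Real.sqrt (nsq u) * Real.sqrt (nsq v)) :=
  calG_form_decay n hn M a ha ρ (fun e => ctRowDefect_DeltaA_le_of_pieces n hn M a ρ hℓ hL hP e)
    hκ hm hu hv

end Assembly

end

end Literature.MathematicalPhysics.QuantumFieldTheory.Balaban1983to89.Beta.DeltaACombesThomas
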